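import Summits.Ventures.PercRepro.ProfileGapMonoThresholdWGeneric

/-!
# PercRepro — THE BI-COLOOP IDENTITY, DEMAND SIDE: THE THRESHOLD DEMAND OF ANY NON-LOOP POINT SPLITS UP TO THE
BI-COLOOP CORRECTIONS (p5, gen 25; `proofs/P5-GM1.md` §25(i); announced INBOX before sending)

For a non-loop `z` of `N` call `X ⊆ E' := E ∖ z` BI-COLOOP if `z ∉ cl(X)` and `z ∉ cl(E' ∖ X)`.  With the correction
`lostCorr N z t X = [z ∉ cl(E' ∖ X)] · (d(m'+1) − d(m'))` (`m' := ρ(E' ∖ X)`, `d(m) = [t+1 ≤ m] · m`):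
`thresholdSum N q t + Σ_{W₂} lostCorr = thresholdSum (N ∖ z) q t + thresholdSum (N ／ z) (q−1) (t−1) + #L' + Σ_{W₁} lostCorr`,
`W₁` / `W₂` the `z`-free sets of rank `q − 1` / `q − 2` with `z ∉ cl(B)` (the correction vanishes unless `B` is
bi-coloop) — the lost `z`-free sets with `z ∈ cl(B)` cancel against the over-counted rank-`(q−2)` sets of `N ／ z` with
`ρ_N = q − 1` (`matched_lost_eq_matched_over`, the general form of `lostSets_eq_overSets_of_wGeneric`), and the
remaining corrections are exactly the bi-coloop ones (`over_eq_biColoop_pred`).  The supply side and the identity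
itself are in `ProfileGapMonoThresholdBiColoop`.

* `matched_lost_eq_matched_over`, `over_eq_biColoop_pred`, **`thresholdSum_biColoop`**.
-/

open scoped Matroid

namespace PercRepro.Cogirth

open Finset ThmH Skew Shadow Profile

variable {α : Type} [DecidableEq α] {M : Matroid α} [M.Finite]

section BiColoop

variable {N : Matroid α} [N.Finite] {z : α} {q t : ℕ}

/-- **The lost `z`-free rank-`(q−1)` sets with `z ∈ cl(B)` are the over-counted rank-`(q−2)` sets of `N ／ z` with
`z ∈ cl(B')`** (`2 ≤ q`). -/
theorem matched_lost_eq_matched_over (hzI : N.Indep {z}) (hq : 2 ≤ q) :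
    (Rq N (q - 1)).filter (fun B => z ∉ B ∧ z ∈ clF N B) =
      (Rq (N ／ ({z} : Set α)) (q - 2)).filter (fun B' => z ∈ clF N B') := by
  have hz : z ∈ gr N := mem_gr_of_indep hzI
  ext B
  simp only [mem_filter, mem_Rq, gr_contract']
  constructor
  · rintro ⟨⟨hBg, hBr⟩, hzB, hcl⟩
    have hrk : rk N B = q - 1 := rk_eq_of_eRk_eq_cq hBr
    have hBE : B ⊆ (gr N).erase z := subset_erase.2 ⟨hBg, hzB⟩
    have h1 := rk_contract_add_one hzI hBE
    rw [rk_insert_eq hz hBg, if_pos hcl, hrk] at h1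
    exact ⟨⟨hBE, eRk_eq_of_rk_eq_cq (by omega)⟩, hcl⟩
  · rintro ⟨⟨hBE, hBr⟩, hcl⟩
    have hzB : z ∉ B := fun h => (mem_erase.1 (hBE h)).1 rfl
    have hBg : B ⊆ gr N := hBE.trans (erase_subset _ _)
    have hr' : rk (N ／ ({z} : Set α)) B = q - 2 := rk_eq_of_eRk_eq_cq hBr
    have h1 := rk_contract_add_one hzI hBE
    rw [hr', rk_insert_eq hz hBg, if_pos hcl] at h1
    exact ⟨⟨hBg, eRk_eq_of_rk_eq_cq (by omega)⟩, hzB, hcl⟩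

/-- **The over-counted rank-`(q−2)` sets of `N ／ z` with `z ∉ cl(B')` are the `z`-free rank-`(q−2)` sets of `N` with
`z ∉ cl(B')`** (`2 ≤ q`). -/
theorem over_eq_biColoop_pred (hzI : N.Indep {z}) :
    (Rq (N ／ ({z} : Set α)) (q - 2)).filter (fun B' => z ∉ clF N B') =
      (Rq N (q - 2)).filter (fun B' => z ∉ B' ∧ z ∉ clF N B') := by
  have hz : z ∈ gr N := mem_gr_of_indep hzI
  ext B
  simp only [mem_filter, mem_Rq, gr_contract']
  constructor
  · rintro ⟨⟨hBE, hBr⟩, hcl⟩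
    have hzB : z ∉ B := fun h => (mem_erase.1 (hBE h)).1 rfl
    have hBg : B ⊆ gr N := hBE.trans (erase_subset _ _)
    have hr' : rk (N ／ ({z} : Set α)) B = q - 2 := rk_eq_of_eRk_eq_cq hBr
    have h1 := rk_contract_add_one hzI hBE
    rw [hr', rk_insert_eq hz hBg, if_neg hcl] at h1
    exact ⟨⟨hBg, eRk_eq_of_rk_eq_cq (by omega)⟩, hzB, hcl⟩
  · rintro ⟨⟨hBg, hBr⟩, hzB, hcl⟩
    have hrk : rk N B = q - 2 := rk_eq_of_eRk_eq_cq hBr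
    have hBE : B ⊆ (gr N).erase z := subset_erase.2 ⟨hBg, hzB⟩
    have h1 := rk_contract_add_one hzI hBE
    rw [rk_insert_eq hz hBg, if_neg hcl, hrk] at h1
    exact ⟨⟨hBE, eRk_eq_of_rk_eq_cq (by omega)⟩, hcl⟩

/-- **The demand identity at any non-loop point** (`2 ≤ q`, `1 ≤ t`): the threshold demand of `N` plus the
bi-coloop corrections of rank `q − 2` equals the demand of `N ∖ z`, the contraction demand with its `#L'`, plus the
bi-coloop corrections of rank `q − 1`. -/
theorem thresholdSum_biColoop (hzI : N.Indep {z}) (hq : 2 ≤ q) (ht : 1 ≤ t) :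
    thresholdSum N q t +
        ∑ B' ∈ (Rq N (q - 2)).filter (fun B' => z ∉ B' ∧ z ∉ clF N B'), lostCorr N z t B' =
      thresholdSum (N ＼ ({z} : Set α)) q t +
        (thresholdSum (N ／ ({z} : Set α)) (q - 1) (t - 1) +
          ((Rq (N ／ ({z} : Set α)) (q - 2)).filter
            (fun B' => t ≤ rk (N ／ ({z} : Set α)) (gr (N ／ ({z} : Set α)) \ B'))).card) +
        ∑ B ∈ (Rq N (q - 1)).filter (fun B => z ∉ B ∧ z ∉ clF N B), lostCorr N z t B := by
  have hz : z ∈ gr N := mem_gr_of_indep hzI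
  have e1 : q - 1 - 1 = q - 2 := by omega
  have e2 : t - 1 + 1 = t := by omega
  have hsplit : thresholdSum N q t =
      ∑ B ∈ (Rq N (q - 1)).filter (fun B => z ∈ B),
          (if t + 1 ≤ rk N (gr N \ B) then rk N (gr N \ B) else 0) +
        ∑ B ∈ (Rq N (q - 1)).filter (fun B => z ∉ B),
          (if t + 1 ≤ rk N (gr N \ B) then rk N (gr N \ B) else 0) := by
    unfold thresholdSum
    rw [sum_filter_add_sum_filter_not]
  have hfree : ∑ B ∈ (Rq N (q - 1)).filter (fun B => z ∉ B),
      (if t + 1 ≤ rk N (gr N \ B) then rk N (gr N \ B) else 0) =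
      thresholdSum (N ＼ ({z} : Set α)) q t +
        ∑ B ∈ (Rq N (q - 1)).filter (fun B => z ∉ B), lostCorr N z t B := by
    unfold thresholdSum
    rw [Rq_delete_eq_filter, ← sum_add_distrib]
    refine sum_congr rfl (fun B hB => ?_)
    rw [mem_filter] at hB
    have hBE : B ⊆ (gr N).erase z := subset_erase.2 ⟨(mem_Rq.1 hB.1).1, hB.2⟩
    exact thresholdTerm_delete_of_wGeneric (t := t) hz hBE
  have hthru : ∑ B ∈ (Rq N (q - 1)).filter (fun B => z ∈ B),
      (if t + 1 ≤ rk N (gr N \ B) then rk N (gr N \ B) else 0) +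
      ∑ B' ∈ Rq (N ／ ({z} : Set α)) (q - 2), lostCorr N z t B' =
      thresholdSum (N ／ ({z} : Set α)) (q - 1) (t - 1) +
        ((Rq (N ／ ({z} : Set α)) (q - 2)).filter
          (fun B' => t ≤ rk (N ／ ({z} : Set α)) (gr (N ／ ({z} : Set α)) \ B'))).card := by
    rw [sum_Rq_filter_mem_contract hzI (by omega : 1 ≤ q - 1), e1, ← sum_add_distrib]
    unfold thresholdSum
    rw [e1, e2, card_filter, ← sum_add_distrib]
    refine sum_congr rfl (fun B' _ => ?_)
    have h := thresholdTerm_insert_of_wGeneric (t := t) (B' := B') hzI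
    unfold lostCorr
    rw [h]
    split_ifs <;> omega
  -- split the two correction sums by `z ∈ cl(B)`
  have hfreeSplit : ∑ B ∈ (Rq N (q - 1)).filter (fun B => z ∉ B), lostCorr N z t B =
      ∑ B ∈ (Rq N (q - 1)).filter (fun B => z ∉ B ∧ z ∈ clF N B), lostCorr N z t B +
        ∑ B ∈ (Rq N (q - 1)).filter (fun B => z ∉ B ∧ z ∉ clF N B), lostCorr N z t B := by
    rw [← sum_filter_add_sum_filter_not ((Rq N (q - 1)).filter (fun B => z ∉ B)) (fun B => z ∈ clF N B),
      filter_filter, filter_filter]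
  have hoverSplit : ∑ B' ∈ Rq (N ／ ({z} : Set α)) (q - 2), lostCorr N z t B' =
      ∑ B' ∈ (Rq (N ／ ({z} : Set α)) (q - 2)).filter (fun B' => z ∈ clF N B'), lostCorr N z t B' +
        ∑ B' ∈ (Rq N (q - 2)).filter (fun B' => z ∉ B' ∧ z ∉ clF N B'), lostCorr N z t B' := by
    rw [← sum_filter_add_sum_filter_not (Rq (N ／ ({z} : Set α)) (q - 2)) (fun B' => z ∈ clF N B'),
      over_eq_biColoop_pred hzI]
  rw [matched_lost_eq_matched_over hzI hq] at hfreeSplit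
  rw [hsplit, hfree]
  rw [hfreeSplit] 
  rw [hoverSplit] at hthru
  omega

end BiColoop

end PercRepro.Cogirth
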